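import Literature.NumberTheory.GaloisRepresentations.TameInertiaCharacterProofs
import Literature.NumberTheory.GaloisRepresentations.UnramifiedInertiaCocycleFrobeniusTwistProofs
import HarnessLib

/-!
# A tame `p`-generator of the inertia group, and `H¹(I_F, A) ≃ A` by evaluation (theorems only)

Topic `NumberTheory/GaloisRepresentations`; namespace `Literature.NumberTheory.GaloisRepresentations`.
THEOREMS ONLY (no definition, no named fact, no `sorry`; D-0026). Cell `bsd-stepL`, K2 support 20495
(`JSWSigmaLocalCharIdeal`), step (S5): the generic local-Galois input "`H¹(I_w, A) = Hom(ℤ_p(1), A) ≅ A`"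
consumed together with `UnramifiedInertiaCocycleFrobeniusTwistProofs` (Frobenius acts as `q⁻¹ρ(φ)`) and
`TateModulePontryaginDualCharpolyProofs` (the Tate-module bridge).

Let `F` be a non-archimedean local field with residue characteristic `ℓ`, `I_F = absInertia F` its inertia
group, and `p ≠ ℓ` a prime. Serre (§1.2–1.3): the wild inertia group is the largest pro-`ℓ` subgroup of
`I_F`, the tame quotient is `I_t ≃ lim← μ_d` (`(d, ℓ) = 1`, Prop. 1) through the Kummer characters
`θ_d(s) = s(x^{1/d})/x^{1/d}` of a uniformiser `x`, and (§1.7 Prop. 5) the continuous characters of `I_t`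
are the `ψ ∘ θ_d`. Consequently a continuous homomorphism of `I_F` into a `p`-group factors through the
pro-`p` part `lim← μ_{p^n} ≅ ℤ_p(1)` of `I_t`, which is pro-cyclic; Greenberg–Vatsal (proof of Prop. 2.4):
"`I_ℓ` contains a unique subgroup `J_ℓ` with `I_ℓ/J_ℓ ≅ ℤ_p(1)` … if `ε_ℓ` is a topological generator,
`H¹(Ī_ℓ, A) ≅ Hom(ℤ_p(1), A_{I_ℓ}) ≅ A_{I_ℓ}(−1)`". This file proves, in the tree's finite-level language
(`kummerCharacter`, `absInertia_exists_eq_mul_zpow`: tame quotients of `I_F` are cyclic):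

* `range_eq_zpowers_of_isPrimitiveRoot` — at a level `d` prime to `ℓ`, if `θ_d(σ₀)` is a PRIMITIVE `d`-th
  root of unity then every continuous homomorphism `f : I_F → B` into a discrete group with `f^d = 1` has
  cyclic image generated by `f σ₀`; additive corollaries `apply_eq_zero_of_apply_eq_zero_of_isPrimitiveRoot`
  (a continuous homomorphism into a discrete abelian group of exponent `d` vanishing at `σ₀` vanishes) and
  `exists_continuous_apply_eq_of_isPrimitiveRoot` (every `a` with `d • a = 0` is a value `f σ₀`);
* `exists_forall_isPrimitiveRoot_kummerCharacter` — **a uniform tame `p`-generator**: one `σ₀ ∈ I_F` at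
  which `θ_{p^n}(σ₀)` is a primitive `p^n`-th root of unity for every `n` (any `σ₀` moving the chosen
  `p`-th root of the uniformiser by a primitive `p`-th root of unity);
* `range_eq_zpowers_of_forall_isPrimitiveRoot`, `eval_bijective_of_forall_isPrimitiveRoot`,
  `exists_absInertia_tame_generator` — for such `σ₀`: every continuous homomorphism of `I_F` into a
  discrete `p`-group `B` has image `⟨f σ₀⟩`, and for every discrete `p`-primary abelian group `A`
  evaluation at `σ₀` is a bijection `Hom_cont(I_F, A) ≃ A`;
* `continuousCohomology_absInertia_equiv_eval_of_bijective`,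
  `exists_forall_continuousCohomology_absInertia_equiv_eval`, `exists_continuousCohomology_absInertia_equiv_eval`
  — for a continuous `ρ : Γ_F → Aut_{ℤ_p}(A)` on a discrete `p`-primary UNRAMIFIED `A` (`I_F` acts
  trivially, so `H¹ = Hom_cont`, `ContinuousH1TrivialAction`), a `ℤ_p`-linear bijection
  **`e : H¹_cont(I_F, A) ≃ A`, `e [z] = z(τ)`**, with `τ` a tame `p`-generator (uniform in `A`);
* `residueFieldCard_nsmul_equiv_conjMap` — under `e` the conjugation action of a Frobenius `φ` satisfies
  **`q • e(φ·c) = ρ(φ)(e c)`** ("`H¹(I_F, A) ≅ A(−1)`"), from `residueFieldCard_nsmul_conj_pullback_apply`.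

## Proof

At level `d`: for `f : I_F → B` continuous with `f^d = 1` put `N = ker f ∩ ker θ_d`; `ker f` is open and
`ker θ_d ⊇ Stab(x^{1/d})`, so `N` contains the `d`-th powers and the elements restricting trivially to a
finite Galois level, whence `I_F = N⟨g⟩` (`absInertia_exists_eq_mul_zpow`, Serre *Local Fields* IV §2);
`θ_d(g)` generates `θ_d(I_F) ∋ θ_d(σ₀)`, so it is a primitive `d`-th root and `σ₀ ∈ N g^{m}` with
`gcd(m, d) = 1`; as `f(g)^d = 1`, `f(g)` is a power of `f(g)^m = f(σ₀)`, and `f(I_F) = ⟨f(g)⟩ = ⟨f(σ₀)⟩`.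
Surjectivity: `σ ↦ e(σ) • a` with `θ_d(σ) = θ_d(σ₀)^{e(σ)}` is a continuous homomorphism (constant on the
cosets of the open stabiliser of `x^{1/d}`). Uniformity: if `σ₀ z₁ = ζ z₁` (`z₁^p = x`, `ζ` a primitive `p`-th
root of unity; `exists_mem_absInertia_smul_eq_mul`) and `w` is the chosen root of level `p^{m+1}`, then
`σ₀ ∈ I_F` fixes the `p`-th root of unity `w^{p^m}/z₁` (`mem_absInertia_iff_smul_rootsOfUnity`), so
`θ_{p^{m+1}}(σ₀)^{p^m} ≡ ζ ≢ 1 (mod 𝔓)` (roots of unity of order prime to `ℓ` are distinct mod `𝔓`,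
`eq_one_of_pow_eq_one_of_sub_one_mem_absMaximalIdeal`). A continuous map of the compact `I_F` into a
discrete `p`-primary group is killed by one `p^N`, which reduces the `p`-primary statements to level `p^N`.

## References

* [SerreInventiones1972] J.-P. Serre, *Propriétés galoisiennes des points d'ordre fini des courbes
  elliptiques*, Invent. Math. 15 (1972), §1.2 (`I_p` the largest pro-`p` subgroup, `I_t = I/I_p`), §1.3
  (`θ_d : Gal(K_d/K_nr) ≃ μ_d`; Prop. 1: `θ : I_t ≃ lim← μ_d`), §1.7 Prop. 5 (characters of `I_t`),
  §1.8 Prop. 6 (conjugation by Frobenius) — read in *Œuvres* III (Springer), no. 94.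
* [GreenbergVatsal2000] R. Greenberg, V. Vatsal, *On the Iwasawa invariants of elliptic curves*, Invent.
  Math. 142 (2000), §2, proof of Prop. (2.4) (arXiv p. 22: `I_ℓ/J_ℓ ≅ ℤ_p(1)`, topological generator `ε_ℓ`,
  `H¹(Ī_ℓ, A) ≅ Hom(ℤ_p(1), A_{I_ℓ}) ≅ A_{I_ℓ}(−1)`).
* [SerreGaloisCohomology1997] J.-P. Serre, *Galois Cohomology* (1997), I §2.3 (`H¹ = Hom` for a trivial
  module).
* [SerreLocalFields1979] J.-P. Serre, *Local Fields*, GTM 67, Ch. IV §2 (Cor. 1 and 3 of Prop. 7).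
-/

noncomputable section

open ValuativeRel Field
open scoped Pointwise Valued IntermediateField

namespace Literature.NumberTheory.GaloisRepresentations

open GaloisRepresentations.IsNonarchimedeanLocalField

/-! ### Uniform exponents on a compact group -/

section Compact

variable {G : Type*} [TopologicalSpace G] [CompactSpace G]

/-- A continuous map from a compact space to a discrete `p`-primary abelian group is killed by one
power of `p` (its image is finite). [folklore] -/
private theorem exists_forall_pow_smul_apply_eq_zero {A : Type*} [AddCommGroup A] [TopologicalSpace A]
    [DiscreteTopology A] {p : ℕ} (hA : ∀ a : A, ∃ k : ℕ, p ^ k • a = 0) {f : G → A} (hf : Continuous f) :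
    ∃ N : ℕ, ∀ g, p ^ N • f g = 0 := by
  choose k hk using hA
  obtain ⟨N, hN⟩ := ((isCompact_range hf).finite_of_discrete.image k).bddAbove
  refine ⟨N, fun g => ?_⟩
  have hle : k (f g) ≤ N := hN (Set.mem_image_of_mem k (Set.mem_range_self g))
  rw [← Nat.sub_add_cancel hle, pow_add, mul_smul, hk, smul_zero]

/-- A continuous map from a compact space to a discrete `p`-group is killed by one power of `p`
(its image is finite). [folklore] -/
private theorem exists_forall_pow_pow_eq_one {B : Type*} [Monoid B] [TopologicalSpace B]
    [DiscreteTopology B] {p : ℕ} (hB : ∀ b : B, ∃ k : ℕ, b ^ p ^ k = 1) {f : G → B} (hf : Continuous f) :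
    ∃ N : ℕ, ∀ g, f g ^ p ^ N = 1 := by
  choose k hk using hB
  obtain ⟨N, hN⟩ := ((isCompact_range hf).finite_of_discrete.image k).bddAbove
  refine ⟨N, fun g => ?_⟩
  have hle : k (f g) ≤ N := hN (Set.mem_image_of_mem k (Set.mem_range_self g))
  rw [← Nat.sub_add_cancel hle, pow_add, mul_comm, pow_mul, hk, one_pow]

end Compact

/-! ### Level `d`: continuous homomorphisms of `I_F` of exponent `d` are generated at `σ₀` -/

section Level

variable (F : Type*) [Field F] [ValuativeRel F] [TopologicalSpace F] [IsNonarchimedeanLocalField F]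
variable {k : Type*} [Field k]

/-- **Level `d`: the image is cyclic, generated at `σ₀`.** Let `θ_d = kummerCharacter F hd hϖ.ne_zero ι`
be the Kummer character of a uniformiser `ϖ` at a level `d` prime to the residue characteristic, and let
`σ₀ ∈ I_F` be an element at which `θ_d` takes a PRIMITIVE `d`-th root of unity. Then every continuous
homomorphism `f : I_F → B` into a discrete group with `f ^ d = 1` has image `f(I_F) = ⟨f σ₀⟩`.
(With `N = ker f ∩ ker θ_d` the tame quotient `I_F / N` is cyclic, `I_F = N⟨g⟩`
(`absInertia_exists_eq_mul_zpow`); `θ_d g` is a primitive `d`-th root and `σ₀ ∈ N g^{m}` with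
`gcd(m, d) = 1`, so `f g` is a power of `f σ₀ = f(g)^m`. Serre: `θ_d : Gal(K_d/K_nr) ≃ μ_d`,
`θ : I_t ≃ lim← μ_d`, so a tame homomorphism of exponent `d` factors through the cyclic `μ_d`.)
[cite: SerreInventiones1972, §1.3 (θ_d isomorphisme) and Prop. 1; §1.7 Prop. 5] -/
theorem range_eq_zpowers_of_isPrimitiveRoot
    (ι : absIntegers 𝒪[F] F ⧸ absMaximalIdeal F →+* k) {d : ℕ} (hd : 0 < d)
    (hpd : ¬ ringChar 𝓀[F] ∣ d) {ϖ : 𝒪[F]} (hϖ : Irreducible ϖ) {σ₀ : ↥(absInertia F)}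
    (hσ₀ : IsPrimitiveRoot (kummerCharacter F hd hϖ.ne_zero ι σ₀) d)
    {B : Type*} [Group B] [TopologicalSpace B] [DiscreteTopology B]
    (f : ↥(absInertia F) →* B) (hf : Continuous f) (hfd : ∀ σ, f σ ^ d = 1) :
    f.range = Subgroup.zpowers (f σ₀) := by
  classical
  set θ := kummerCharacter F hd hϖ.ne_zero ι with hθdef
  set z : AlgebraicClosure F := (kummerRoot F hd ϖ : AlgebraicClosure F) with hzdef
  have hz : z ^ d = algebraMap 𝒪[F] (AlgebraicClosure F) ϖ := coe_kummerRoot_pow F hd ϖ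
  have hθd : ∀ σ : ↥(absInertia F), θ σ ^ d = 1 := fun σ =>
    kummerCharacter_pow_eq_one hd hϖ.ne_zero ι σ
  have hθfix : ∀ σ : ↥(absInertia F), (σ : absoluteGaloisGroup F) • z = z → θ σ = 1 := fun σ hσ =>
    kummerCharacter_eq_one_of_smul_eq hd hϖ.ne_zero ι σ hσ
  -- Step 1: the open neighbourhood `U` of `1` and the finite Galois level `E`
  have hzi : IsIntegral F z :=
    IsIntegral.of_pow hd (by rw [hz, IsScalarTower.algebraMap_apply 𝒪[F] F (AlgebraicClosure F)]; exact isIntegral_algebraMap)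
  haveI : FiniteDimensional F F⟮z⟯ := IntermediateField.adjoin.finiteDimensional hzi
  have hkerOpen : IsOpen {σ : ↥(absInertia F) | f σ = 1} :=
    (isOpen_discrete ({1} : Set B)).preimage hf
  obtain ⟨V, hV, hVeq⟩ := isOpen_induced_iff.mp hkerOpen
  set U : Set (absoluteGaloisGroup F) :=
    V ∩ {σ | absoluteGaloisGroup.toAlgEquiv F σ ∈ F⟮z⟯.fixingSubgroup} with hUdef
  have hUopen : IsOpen U := hV.inter (IntermediateField.fixingSubgroup_isOpen F⟮z⟯)
  have h1U : (1 : absoluteGaloisGroup F) ∈ U := by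
    refine ⟨?_, ?_⟩
    · have : (1 : ↥(absInertia F)) ∈ Subtype.val ⁻¹' V := by
        rw [hVeq]; exact map_one f
      exact this
    · rw [Set.mem_setOf_eq, map_one]; exact Subgroup.one_mem _
  obtain ⟨E, hfin, hgal, hE⟩ := exists_isGalois_mem_of_restrict_eq_one F hUopen h1U
  -- the subgroup `N = ker f ⊓ ker θ`
  set N : Subgroup ↥(absInertia F) := f.ker ⊓ θ.ker with hNdef
  have hNd : ∀ τ : ↥(absInertia F), τ ^ d ∈ N := fun τ =>
    Subgroup.mem_inf.mpr ⟨MonoidHom.mem_ker.mpr (by rw [map_pow, hfd]),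
      MonoidHom.mem_ker.mpr (by rw [map_pow, hθd])⟩
  have hNE : ∀ τ : ↥(absInertia F), absRestrictNormalHom E (τ : absoluteGaloisGroup F) = 1 → τ ∈ N := by
    intro τ hτ
    obtain ⟨hτV, hτz⟩ := hE _ hτ
    refine Subgroup.mem_inf.mpr ⟨?_, MonoidHom.mem_ker.mpr ?_⟩
    · have : τ ∈ Subtype.val ⁻¹' V := hτV
      rw [hVeq] at this
      exact MonoidHom.mem_ker.mpr this
    · refine hθfix τ ?_
      rw [absoluteGaloisGroup.smul_def]
      exact (IntermediateField.mem_fixingSubgroup_iff _ _).mp hτz z (IntermediateField.mem_adjoin_simple_self F z)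
  -- Step 2: `I_F = N ⟨g⟩`
  obtain ⟨g, hg⟩ := absInertia_exists_eq_mul_zpow F hpd N hNd E hNE
  have hfeval : ∀ (ν : ↥(absInertia F)) (_ : ν ∈ N) (n : ℤ), f (ν * g ^ n) = f g ^ n := fun ν hν n => by
    rw [map_mul, map_zpow, show f ν = 1 from MonoidHom.mem_ker.mp (Subgroup.mem_inf.mp hν).1, one_mul]
  have hθeval : ∀ (ν : ↥(absInertia F)) (_ : ν ∈ N) (n : ℤ), θ (ν * g ^ n) = θ g ^ n := fun ν hν n => by
    rw [map_mul, map_zpow, show θ ν = 1 from MonoidHom.mem_ker.mp (Subgroup.mem_inf.mp hν).2, one_mul]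
  -- Step 3: `t = θ g` is a primitive `d`-th root of unity and `σ₀ = ν₀ g^{m₀}` with `gcd(m₀, d) = 1`
  obtain ⟨m₀, ν₀, hν₀, hσν⟩ := hg σ₀
  set t : kˣ := θ g with htdef
  have ht : IsPrimitiveRoot t d := by
    have hmem : θ σ₀ ∈ Subgroup.zpowers t := by
      rw [hσν, hθeval ν₀ hν₀ m₀]
      exact Subgroup.zpow_mem _ (Subgroup.mem_zpowers t) m₀
    have hdvd : d ∣ orderOf t := by
      rw [hσ₀.eq_orderOf]
      exact orderOf_dvd_of_mem_zpowers hmem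
    have hdvd' : orderOf t ∣ d := orderOf_dvd_of_pow_eq_one (hθd g)
    have horder : orderOf t = d := Nat.dvd_antisymm hdvd' hdvd
    rw [← horder]
    exact IsPrimitiveRoot.orderOf t
  set r : ℕ := (m₀ % (d : ℤ)).toNat with hrdef
  have hr0 : ((r : ℕ) : ℤ) = m₀ % (d : ℤ) :=
    Int.toNat_of_nonneg (Int.emod_nonneg _ (by exact_mod_cast hd.ne'))
  have hm₀ : m₀ = (d : ℤ) * (m₀ / (d : ℤ)) + (r : ℤ) := by rw [hr0, Int.mul_ediv_add_emod]
  have htr : t ^ m₀ = t ^ r := by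
    rw [hm₀, zpow_add, zpow_mul, zpow_natCast, ht.pow_eq_one, one_zpow, one_mul, zpow_natCast]
  have hfgr : f g ^ m₀ = f g ^ r := by
    rw [hm₀, zpow_add, zpow_mul, zpow_natCast, hfd g, one_zpow, one_mul, zpow_natCast]
  have hrcop : r.Coprime d := by
    have hprim : IsPrimitiveRoot (t ^ r) d := by
      rw [← htr, htdef, ← hθeval ν₀ hν₀ m₀, ← hσν]; exact hσ₀
    exact (ht.pow_iff_coprime hd r).1 hprim
  -- Step 4: `f g` is a power of `f σ₀ = f(g)^r`
  have hfσ₀ : f σ₀ = f g ^ r := by rw [hσν, hfeval ν₀ hν₀ m₀, hfgr]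
  have hfg : f g ∈ Subgroup.zpowers (f σ₀) := by
    obtain ⟨m, hm⟩ := exists_pow_eq_self_of_coprime
      (hrcop.coprime_dvd_right (orderOf_dvd_of_pow_eq_one (hfd g)))
    rw [hfσ₀, Subgroup.mem_zpowers_iff]
    exact ⟨m, by rw [zpow_natCast, hm]⟩
  -- conclusion
  refine le_antisymm ?_ (Subgroup.zpowers_le.mpr ⟨σ₀, rfl⟩)
  rintro _ ⟨σ, rfl⟩
  obtain ⟨n, ν, hν, rfl⟩ := hg σ
  rw [hfeval ν hν n]
  exact Subgroup.zpow_mem _ hfg n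

variable {A : Type*} [AddCommGroup A] [TopologicalSpace A] [DiscreteTopology A]

/-- **Level `d`, injectivity of evaluation at `σ₀`.** With `θ_d`, `σ₀` as in
`range_eq_zpowers_of_isPrimitiveRoot` (`θ_d σ₀` a primitive `d`-th root of unity, `d` prime to the residue
characteristic), a continuous homomorphism `f : I_F → A` into a discrete abelian group with `d • f = 0`
and `f σ₀ = 0` vanishes (its image is generated by `f σ₀`).
[cite: SerreInventiones1972, §1.3 (θ_d isomorphisme) and Prop. 1; §1.7 Prop. 5] -/
theorem apply_eq_zero_of_apply_eq_zero_of_isPrimitiveRoot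
    (ι : absIntegers 𝒪[F] F ⧸ absMaximalIdeal F →+* k) {d : ℕ} (hd : 0 < d)
    (hpd : ¬ ringChar 𝓀[F] ∣ d) {ϖ : 𝒪[F]} (hϖ : Irreducible ϖ) {σ₀ : ↥(absInertia F)}
    (hσ₀ : IsPrimitiveRoot (kummerCharacter F hd hϖ.ne_zero ι σ₀) d)
    (f : ↥(absInertia F) → A) (hf : Continuous f) (hmul : ∀ σ τ, f (σ * τ) = f σ + f τ)
    (hfd : ∀ σ, d • f σ = 0) (h0 : f σ₀ = 0) (σ : ↥(absInertia F)) : f σ = 0 := by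
  have hf1 : f 1 = 0 := by
    have h := hmul 1 1
    rw [mul_one] at h
    exact left_eq_add.mp h
  -- `f` as a monoid homomorphism into `Multiplicative A`
  let fm : ↥(absInertia F) →* Multiplicative A :=
    { toFun := fun σ => Multiplicative.ofAdd (f σ)
      map_one' := by rw [hf1]; rfl
      map_mul' := fun σ τ => by rw [hmul]; rfl }
  have hfm : ∀ σ, fm σ = Multiplicative.ofAdd (f σ) := fun _ => rfl
  have hrange := range_eq_zpowers_of_isPrimitiveRoot F ι hd hpd hϖ hσ₀ fm (continuous_ofAdd.comp hf)
    (fun σ => by rw [hfm, ← ofAdd_nsmul, hfd]; rfl)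
  have hmem : fm σ ∈ Subgroup.zpowers (fm σ₀) := hrange ▸ ⟨σ, rfl⟩
  rw [hfm σ₀, h0, ofAdd_zero, Subgroup.zpowers_one_eq_bot, Subgroup.mem_bot, hfm] at hmem
  exact ofAdd_eq_one.mp hmem

/-- **Level `d`, surjectivity of evaluation at `σ₀`.** With `θ_d` and `σ₀` as above (`θ_d σ₀` a
primitive `d`-th root of unity), every `a ∈ A` with `d • a = 0` is the value at `σ₀` of a continuous
homomorphism `f : I_F → A`, namely `f = ψ_a ∘ θ_d` where `ψ_a (θ_d(σ₀) ^ e) = e • a` (the characters of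
`I_t` of exponent `d` are the `ψ ∘ θ_d`, `ψ ∈ Hom(μ_d, -)`).
[cite: SerreInventiones1972, §1.3 (θ_d isomorphisme) and Prop. 1; §1.7 Prop. 5] -/
theorem exists_continuous_apply_eq_of_isPrimitiveRoot
    (ι : absIntegers 𝒪[F] F ⧸ absMaximalIdeal F →+* k) {d : ℕ} (hd : 0 < d)
    {ϖ : 𝒪[F]} (hϖ : Irreducible ϖ) {σ₀ : ↥(absInertia F)}
    (hσ₀ : IsPrimitiveRoot (kummerCharacter F hd hϖ.ne_zero ι σ₀) d) (a : A) (ha : d • a = 0) :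
    ∃ f : ↥(absInertia F) → A, Continuous f ∧ (∀ σ τ, f (σ * τ) = f σ + f τ) ∧ f σ₀ = a := by
  classical
  set θ := kummerCharacter F hd hϖ.ne_zero ι with hθdef
  set z : AlgebraicClosure F := (kummerRoot F hd ϖ : AlgebraicClosure F) with hzdef
  have hθd : ∀ σ : ↥(absInertia F), θ σ ^ d = 1 := fun σ =>
    kummerCharacter_pow_eq_one hd hϖ.ne_zero ι σ
  have hθfix : ∀ σ : ↥(absInertia F), (σ : absoluteGaloisGroup F) • z = z → θ σ = 1 := fun σ hσ =>
    kummerCharacter_eq_one_of_smul_eq hd hϖ.ne_zero ι σ hσ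
  set t : kˣ := θ σ₀ with htdef
  -- exponents: `θ σ = t ^ e σ`
  haveI : NeZero d := ⟨hd.ne'⟩
  have hex : ∀ σ : ↥(absInertia F), ∃ e : ℕ, t ^ e = θ σ := fun σ => by
    obtain ⟨e, -, he⟩ := hσ₀.eq_pow_of_mem_rootsOfUnity ((mem_rootsOfUnity d _).mpr (hθd σ))
    exact ⟨e, he⟩
  choose e he using hex
  have hord : orderOf t = d := hσ₀.eq_orderOf.symm
  have hadd : ∀ σ τ : ↥(absInertia F), e (σ * τ) • a = e σ • a + e τ • a := by
    intro σ τ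
    have h1 : t ^ e (σ * τ) = t ^ (e σ + e τ) := by rw [he, map_mul, pow_add, he, he]
    rw [pow_eq_pow_iff_modEq, hord] at h1
    rw [← add_smul, nsmul_eq_mod_nsmul (e (σ * τ)) ha, h1, ← nsmul_eq_mod_nsmul _ ha]
  -- the candidate `f σ = e σ • a`
  refine ⟨fun σ => e σ • a, ?_, hadd, ?_⟩
  · -- continuity: `f` is constant on the cosets of the open subgroup fixing `z`
    have hzi : IsIntegral F z := IsIntegral.of_pow hd (by
      rw [hzdef, coe_kummerRoot_pow F hd ϖ, IsScalarTower.algebraMap_apply 𝒪[F] F (AlgebraicClosure F)]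
      exact isIntegral_algebraMap)
    haveI : FiniteDimensional F F⟮z⟯ := IntermediateField.adjoin.finiteDimensional hzi
    set W : Set ↥(absInertia F) :=
      Subtype.val ⁻¹' {γ | absoluteGaloisGroup.toAlgEquiv F γ ∈ F⟮z⟯.fixingSubgroup} with hWdef
    have hWopen : IsOpen W := (IntermediateField.fixingSubgroup_isOpen F⟮z⟯).preimage continuous_subtype_val
    have hW0 : ∀ w ∈ W, e w • a = 0 := by
      intro w hw
      have hwz : (w : absoluteGaloisGroup F) • z = z := by
        rw [absoluteGaloisGroup.smul_def]
        exact (IntermediateField.mem_fixingSubgroup_iff _ _).mp hw z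
          (IntermediateField.mem_adjoin_simple_self F z)
      have h1 : t ^ e w = 1 := by rw [he, hθfix w hwz]
      obtain ⟨c, hc⟩ := (hσ₀.pow_eq_one_iff_dvd (e w)).1 h1
      rw [hc, mul_comm, mul_smul, ha, smul_zero]
    refine continuous_discrete_rng.2 fun b => ?_
    refine isOpen_iff_forall_mem_open.2 fun σ hσ => ?_
    refine ⟨(fun x => σ⁻¹ * x) ⁻¹' W, fun x hx => ?_, hWopen.preimage (continuous_const.mul continuous_id),
      ?_⟩
    · have hx' : e x • a = e σ • a + e (σ⁻¹ * x) • a := by rw [← hadd, mul_inv_cancel_left]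
      change e x • a = b
      rw [hx', hW0 _ hx, add_zero]
      exact hσ
    · change σ⁻¹ * σ ∈ W
      rw [inv_mul_cancel, hWdef, Set.mem_preimage, Set.mem_setOf_eq, OneMemClass.coe_one, map_one]
      exact Subgroup.one_mem _
  · -- value at `σ₀`
    have h1 : t ^ e σ₀ = t ^ 1 := by rw [he, pow_one]
    rw [pow_eq_pow_iff_modEq, hord] at h1
    change e σ₀ • a = a
    rw [nsmul_eq_mod_nsmul (e σ₀) ha, h1, ← nsmul_eq_mod_nsmul _ ha, one_smul]

/-- **A uniform tame `p`-generator.** For a prime `p` different from the residue characteristic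
there is ONE `σ₀ ∈ I_F` at which, for every `n`, the Kummer character `θ_{p^n}` of the uniformiser
`ϖ` takes a primitive `p^n`-th root of unity: any `σ₀` moving the chosen `p`-th root `z₁` of `ϖ`
by a primitive `p`-th root of unity `ζ` (surjectivity of `θ_p`, `exists_mem_absInertia_smul_eq_mul`).
Indeed `σ₀ ∈ I_F` fixes the `p`-th root of unity `w^{p^m} / z₁` (`w` the chosen root at level
`p^{m+1}`), so `θ_{p^{m+1}}(σ₀)^{p^m} = ζ mod 𝔓 ≠ 1`, roots of unity of order prime to the residue
characteristic being distinct mod `𝔓`. (Serre: `θ : I_t ≃ lim← μ_d`; the image of `σ₀` in the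
pro-`p` quotient `lim← μ_{p^n} ≅ ℤ_p(1)` is a topological generator.)
[cite: SerreInventiones1972, §1.3 (θ_d isomorphisme) and Prop. 1] -/
theorem exists_forall_isPrimitiveRoot_kummerCharacter
    (ι : absIntegers 𝒪[F] F ⧸ absMaximalIdeal F →+* k) {p : ℕ} (hp : p.Prime)
    (hℓ : ringChar 𝓀[F] ≠ p) {ϖ : 𝒪[F]} (hϖ : Irreducible ϖ) :
    ∃ σ₀ : ↥(absInertia F), ∀ (n : ℕ) (hn : 0 < p ^ n),
      IsPrimitiveRoot (kummerCharacter F hn hϖ.ne_zero ι σ₀) (p ^ n) := by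
  classical
  letI : Field (absIntegers 𝒪[F] F ⧸ absMaximalIdeal F) := Ideal.Quotient.field _
  have hι : Function.Injective ι := ι.injective
  have hpd : ¬ ringChar 𝓀[F] ∣ p := fun h =>
    hℓ ((Nat.prime_dvd_prime_iff_eq (ringChar_residueField_prime (F := F)) hp).mp h)
  have hpu : IsUnit ((p : ℕ) : 𝒪[F]) := isUnit_natCast_of_not_ringChar_dvd F hpd
  haveI := neZero_natCast_of_not_ringChar_dvd (F := F) hpd
  haveI : NeZero ((p : ℕ) : AlgebraicClosure F) :=
    NeZero.nat_of_injective (algebraMap F (AlgebraicClosure F)).injective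
  haveI : NeZero p := ⟨hp.ne_zero⟩
  obtain ⟨ζ, hζ⟩ := HasEnoughRootsOfUnity.exists_primitiveRoot (AlgebraicClosure F) p
  set z₁ : AlgebraicClosure F := (kummerRoot F hp.pos ϖ : AlgebraicClosure F) with hz₁def
  have hz₁ : z₁ ^ p = algebraMap 𝒪[F] (AlgebraicClosure F) ϖ := coe_kummerRoot_pow F hp.pos ϖ
  have hz₁0 : z₁ ≠ 0 := coe_kummerRoot_ne_zero hp.pos hϖ.ne_zero
  obtain ⟨σ₀, hσ₀I, hσ₀⟩ := exists_mem_absInertia_smul_eq_mul hp.pos hϖ hz₁ hζ.pow_eq_one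
  refine ⟨⟨σ₀, hσ₀I⟩, fun n hn => ?_⟩
  cases n with
  | zero =>
    exact (IsPrimitiveRoot.iff_def _ _).2
      ⟨kummerCharacter_pow_eq_one hn hϖ.ne_zero ι _, fun l _ => one_dvd l⟩
  | succ m =>
    set θ : kˣ := kummerCharacter F hn hϖ.ne_zero ι ⟨σ₀, hσ₀I⟩ with hθdef
    have hθd : θ ^ p ^ (m + 1) = 1 := kummerCharacter_pow_eq_one hn hϖ.ne_zero ι _
    -- the chosen root `w` at level `p^(m+1)`; `w^(p^m)` is another `p`-th root of `ϖ`
    set w : AlgebraicClosure F := (kummerRoot F hn ϖ : AlgebraicClosure F) with hwdef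
    have hw : w ^ p ^ (m + 1) = algebraMap 𝒪[F] (AlgebraicClosure F) ϖ := coe_kummerRoot_pow F hn ϖ
    have hw0 : w ≠ 0 := coe_kummerRoot_ne_zero hn hϖ.ne_zero
    have hη : (w ^ p ^ m / z₁) ^ p = 1 := by
      rw [div_pow, ← pow_mul, ← pow_succ, hw, ← hz₁, div_self (pow_ne_zero _ hz₁0)]
    have hση : σ₀ • (w ^ p ^ m / z₁) = w ^ p ^ m / z₁ :=
      mem_absInertia_iff_smul_rootsOfUnity.mp hσ₀I p hpu _ hη
    have hσW : σ₀ • w ^ p ^ m = ζ * w ^ p ^ m := by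
      have h1 : w ^ p ^ m = w ^ p ^ m / z₁ * z₁ := (div_mul_cancel₀ _ hz₁0).symm
      rw [h1, smul_mul', hση, hσ₀, mul_left_comm]
    -- the Kummer cocycle at level `p^(m+1)`: `c(σ₀) ^ (p^m) = ζ`
    have hc : ((kummerCocycleInt F hn hϖ.ne_zero σ₀ ^ p ^ m : absIntegers 𝒪[F] F) :
        AlgebraicClosure F) = ζ := by
      rw [SubmonoidClass.coe_pow, coe_kummerCocycleInt, kummerCocycle, div_pow, ← smul_pow',
        ← hwdef, hσW, mul_div_assoc, div_self (pow_ne_zero _ hw0), mul_one]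
    -- `θ ^ (p^m) ≠ 1`
    have hne : θ ^ p ^ m ≠ 1 := by
      intro h1
      apply hζ.ne_one hp.one_lt
      have h1' : (θ : k) ^ p ^ m = 1 := by rw [← Units.val_pow_eq_pow_val, h1, Units.val_one]
      rw [hθdef, coe_kummerCharacter_apply, ← map_pow, ← map_pow, ← ι.map_one] at h1'
      have h2 : kummerCocycleInt F hn hϖ.ne_zero σ₀ ^ p ^ m - 1 ∈ absMaximalIdeal F := by
        refine Ideal.Quotient.eq.mp ?_
        rw [map_one]
        exact hι h1'
      have h3 : kummerCocycleInt F hn hϖ.ne_zero σ₀ ^ p ^ m = 1 :=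
        eq_one_of_pow_eq_one_of_sub_one_mem_absMaximalIdeal hpu
          (by rw [← pow_mul, ← pow_succ]; exact kummerCocycleInt_pow hn hϖ.ne_zero σ₀) h2
      have h4 := congrArg Subtype.val h3
      rwa [hc, OneMemClass.coe_one] at h4
    -- hence `orderOf θ = p^(m+1)`
    have hord : orderOf θ ∣ p ^ (m + 1) := orderOf_dvd_of_pow_eq_one hθd
    obtain ⟨j, hj, hj'⟩ := (Nat.dvd_prime_pow hp).1 hord
    have hjm : j = m + 1 := by
      by_contra hne'
      apply hne
      apply orderOf_dvd_iff_pow_eq_one.mp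
      rw [hj']
      exact pow_dvd_pow p (by omega)
    have horder : orderOf θ = p ^ (m + 1) := by rw [hj', hjm]
    exact (IsPrimitiveRoot.iff_def _ _).2 ⟨hθd, fun l hl => horder ▸ orderOf_dvd_of_pow_eq_one hl⟩

/-! ### `p`-primary targets: the generator property and the evaluation bijection at `σ₀` -/

/-- **Every continuous homomorphism of `I_F` into a discrete `p`-group has cyclic image generated at a
tame `p`-generator.** If `θ_{p^n}(σ₀)` is a primitive `p^n`-th root of unity for all `n`
(`exists_forall_isPrimitiveRoot_kummerCharacter`) and `p ≠` residue characteristic, then for every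
discrete `p`-group `B` (every element of `p`-power order) and every continuous `f : I_F →* B`,
`f(I_F) = ⟨f σ₀⟩`. (The image is a finite `p`-group, `I_F` being compact, so `f` has exponent `p^N` and
`range_eq_zpowers_of_isPrimitiveRoot` applies at level `p^N`; Serre: `I_t ≃ lim← μ_d` and the wild
inertia is pro-`ℓ`; Greenberg–Vatsal: "`I_ℓ/J_ℓ ≅ ℤ_p(1)`, `ε_ℓ` a topological generator".)
[cite: SerreInventiones1972, §1.2–§1.3 Prop. 1]
[cite: GreenbergVatsal2000, §2, proof of Prop. (2.4) (arXiv p. 22)] -/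
theorem range_eq_zpowers_of_forall_isPrimitiveRoot
    (ι : absIntegers 𝒪[F] F ⧸ absMaximalIdeal F →+* k) {p : ℕ} (hp : p.Prime)
    (hℓ : ringChar 𝓀[F] ≠ p) {ϖ : 𝒪[F]} (hϖ : Irreducible ϖ) {σ₀ : ↥(absInertia F)}
    (hσ₀ : ∀ (n : ℕ) (hn : 0 < p ^ n), IsPrimitiveRoot (kummerCharacter F hn hϖ.ne_zero ι σ₀) (p ^ n))
    {B : Type*} [Group B] [TopologicalSpace B] [DiscreteTopology B] (hB : IsPGroup p B)
    (f : ↥(absInertia F) →* B) (hf : Continuous f) : f.range = Subgroup.zpowers (f σ₀) := by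
  haveI : CompactSpace (absoluteGaloisGroup F) := absoluteGaloisGroup_compactSpace F
  haveI : CompactSpace (absInertia F) :=
    isCompact_iff_compactSpace.mp (isClosed_absInertia_holds F).isCompact
  have hpd : ∀ n : ℕ, ¬ ringChar 𝓀[F] ∣ p ^ n := fun n h =>
    hℓ ((Nat.prime_dvd_prime_iff_eq (ringChar_residueField_prime (F := F)) hp).mp
      ((ringChar_residueField_prime (F := F)).dvd_of_dvd_pow h))
  obtain ⟨N, hN⟩ := exists_forall_pow_pow_eq_one hB (f := fun σ => f σ) hf
  exact range_eq_zpowers_of_isPrimitiveRoot F ι (pow_pos hp.pos N) (hpd N) hϖ (hσ₀ N _) f hf hN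

/-- **Evaluation at a tame `p`-generator is bijective on `Hom_cont(I_F, A)`** for every discrete
`p`-primary abelian group `A` (`p ≠` residue characteristic): if `θ_{p^n}(σ₀)` is a primitive `p^n`-th
root of unity for all `n`, a continuous homomorphism `f : I_F → A` with `f σ₀ = 0` vanishes, and every
`a ∈ A` is a value `f σ₀`. ("`Hom(I_ℓ, A) = Hom(ℤ_p(1), A) ≅ A`".)
[cite: SerreInventiones1972, §1.3 Prop. 1 and §1.7 Prop. 5]
[cite: GreenbergVatsal2000, §2, proof of Prop. (2.4) (arXiv p. 22)] -/
theorem eval_bijective_of_forall_isPrimitiveRoot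
    (ι : absIntegers 𝒪[F] F ⧸ absMaximalIdeal F →+* k) {p : ℕ} (hp : p.Prime)
    (hℓ : ringChar 𝓀[F] ≠ p) {ϖ : 𝒪[F]} (hϖ : Irreducible ϖ) {σ₀ : ↥(absInertia F)}
    (hσ₀ : ∀ (n : ℕ) (hn : 0 < p ^ n), IsPrimitiveRoot (kummerCharacter F hn hϖ.ne_zero ι σ₀) (p ^ n))
    (A : Type*) [AddCommGroup A] [TopologicalSpace A] [DiscreteTopology A]
    (hA : ∀ a : A, ∃ k : ℕ, p ^ k • a = 0) :
    (∀ f : ↥(absInertia F) → A, Continuous f → (∀ σ τ, f (σ * τ) = f σ + f τ) →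
        f σ₀ = 0 → ∀ σ, f σ = 0) ∧
    (∀ a : A, ∃ f : ↥(absInertia F) → A,
        Continuous f ∧ (∀ σ τ, f (σ * τ) = f σ + f τ) ∧ f σ₀ = a) := by
  haveI : CompactSpace (absoluteGaloisGroup F) := absoluteGaloisGroup_compactSpace F
  haveI : CompactSpace (absInertia F) :=
    isCompact_iff_compactSpace.mp (isClosed_absInertia_holds F).isCompact
  have hpd : ∀ n : ℕ, ¬ ringChar 𝓀[F] ∣ p ^ n := fun n h =>
    hℓ ((Nat.prime_dvd_prime_iff_eq (ringChar_residueField_prime (F := F)) hp).mp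
      ((ringChar_residueField_prime (F := F)).dvd_of_dvd_pow h))
  refine ⟨fun f hf hmul h0 => ?_, fun a => ?_⟩
  · obtain ⟨N, hN⟩ := exists_forall_pow_smul_apply_eq_zero hA hf
    exact apply_eq_zero_of_apply_eq_zero_of_isPrimitiveRoot F ι (pow_pos hp.pos N) (hpd N) hϖ
      (hσ₀ N _) f hf hmul hN h0
  · obtain ⟨n, hn⟩ := hA a
    exact exists_continuous_apply_eq_of_isPrimitiveRoot F ι (pow_pos hp.pos n) hϖ (hσ₀ n _) a hn

/-- **A tame `p`-generator of `I_F`** (packaged): for `p ≠` residue characteristic there is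
`σ₀ ∈ I_F` such that (1) every continuous homomorphism of `I_F` into a discrete `p`-group `B` has image
`⟨f σ₀⟩`, and (2) for every discrete `p`-primary abelian group `A`, evaluation at `σ₀` is a bijection
`Hom_cont(I_F, A) ≃ A`. (Greenberg–Vatsal: "`I_ℓ` contains a unique subgroup `J_ℓ` … of profinite order
prime to `p` with `I_ℓ/J_ℓ ≅ ℤ_p(1)`; `ε_ℓ` a topological generator; `Hom(ℤ_p(1), A) ≅ A(−1)`".)
[cite: GreenbergVatsal2000, §2, proof of Prop. (2.4) (arXiv p. 22)]
[cite: SerreInventiones1972, §1.2–§1.3 Prop. 1 and §1.7 Prop. 5] -/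
theorem exists_absInertia_tame_generator {p : ℕ} (hp : p.Prime) (hℓ : ringChar 𝓀[F] ≠ p) :
    ∃ σ₀ : ↥(absInertia F),
      (∀ (B : Type*) [Group B] [TopologicalSpace B] [DiscreteTopology B], IsPGroup p B →
        ∀ f : ↥(absInertia F) →* B, Continuous f → f.range = Subgroup.zpowers (f σ₀)) ∧
      (∀ (A : Type*) [AddCommGroup A] [TopologicalSpace A] [DiscreteTopology A],
        (∀ a : A, ∃ k : ℕ, p ^ k • a = 0) →
          (∀ f : ↥(absInertia F) → A, Continuous f → (∀ σ τ, f (σ * τ) = f σ + f τ) →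
              f σ₀ = 0 → ∀ σ, f σ = 0) ∧
          (∀ a : A, ∃ f : ↥(absInertia F) → A,
              Continuous f ∧ (∀ σ τ, f (σ * τ) = f σ + f τ) ∧ f σ₀ = a)) := by
  classical
  letI : Field (absIntegers 𝒪[F] F ⧸ absMaximalIdeal F) := Ideal.Quotient.field _
  obtain ⟨ϖ, hϖ⟩ := IsDiscreteValuationRing.exists_irreducible 𝒪[F]
  obtain ⟨σ₀, hσ₀⟩ := exists_forall_isPrimitiveRoot_kummerCharacter F
    (RingHom.id (absIntegers 𝒪[F] F ⧸ absMaximalIdeal F)) hp hℓ hϖ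
  exact ⟨σ₀, fun B _ _ _ hB f hf => range_eq_zpowers_of_forall_isPrimitiveRoot F _ hp hℓ hϖ hσ₀ hB f hf,
    fun A _ _ _ hA => eval_bijective_of_forall_isPrimitiveRoot F _ hp hℓ hϖ hσ₀ A hA⟩

end Level

/-! ### `H¹(I_F, A) ≃ A` by evaluation, for an unramified discrete `p`-primary `ℤ_p[Γ_F]`-module -/

section H1

open CategoryTheory
open _root_.TopRep _root_.ContinuousCohomology

universe u

variable (F : Type u) [Field F] [ValuativeRel F] [TopologicalSpace F] [IsNonarchimedeanLocalField F]
variable {p : ℕ} [Fact p.Prime]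
variable {A : Type u} [AddCommGroup A] [Module ℤ_[p] A] [TopologicalSpace A] [DiscreteTopology A]
  [ContinuousSMul ℤ_[p] A]

/-- **`H¹(I_F, A) = Hom_cont(I_F, A)` evaluated at `τ`.** For a continuous `ρ : Γ_F → Aut_{ℤ_p}(A)` on
a discrete `A` on which `I_F` acts trivially, continuous `1`-cocycles of `I_F` are continuous
homomorphisms and `[·] : Z¹ → H¹` is bijective (`ContinuousH1TrivialAction`); so if evaluation at
`τ ∈ I_F` is injective and surjective on continuous homomorphisms `I_F → A`, then `[z] ↦ z(τ)` is a
`ℤ_p`-linear bijection `H¹_cont(I_F, A) ≃ A` (built with `liftH1ₗ`).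
[cite: SerreGaloisCohomology1997, I §2.3] -/
theorem continuousCohomology_absInertia_equiv_eval_of_bijective
    (ρ : ContinuousRep (absoluteGaloisGroup F) ℤ_[p] A) (hunr : ∀ σ ∈ absInertia F, ∀ a : A, ρ σ a = a)
    (τ : ↥(absInertia F))
    (hinj : ∀ f : ↥(absInertia F) → A, Continuous f → (∀ σ σ', f (σ * σ') = f σ + f σ') →
      f τ = 0 → ∀ σ, f σ = 0)
    (hsurj : ∀ a : A, ∃ f : ↥(absInertia F) → A,
      Continuous f ∧ (∀ σ σ', f (σ * σ') = f σ + f σ') ∧ f τ = a) :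
    ∃ e : continuousCohomology 1 (subgroupRep ρ.toTopRep (absInertia F)) ≃ₗ[ℤ_[p]] A,
      ∀ z, e (oneCocycleClass _ z) = z.1 τ := by
  set X := subgroupRep ρ.toTopRep (absInertia F) with hXdef
  have htriv : ∀ (g : absInertia F) (x : X), X.ρ g x = x := fun g x => hunr g g.2 x
  -- evaluation at `τ` on cocycles
  let ev : contOneCocycles X →ₗ[ℤ_[p]] A :=
    { toFun := fun z => z.1 τ
      map_add' := fun _ _ => rfl
      map_smul' := fun _ _ => rfl }
  have hev : ∀ f, oneCocycleClass X f = 0 → ev f = 0 := fun f hf => by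
    have : f = 0 :=
      oneCocycleClass_injective_of_trivial X htriv (by rw [hf, oneCocycleClass_zero])
    rw [this, map_zero]
  have he₀ : ∀ z, liftH1ₗ X ev hev (oneCocycleClass X z) = z.1 τ := fun z =>
    liftH1ₗ_oneCocycleClass X ev hev z
  have hbij : Function.Bijective (liftH1ₗ X ev hev) := by
    constructor
    · intro x y hxy
      obtain ⟨zx, rfl⟩ := oneCocycleClass_surjective X x
      obtain ⟨zy, rfl⟩ := oneCocycleClass_surjective X y
      rw [he₀, he₀] at hxy
      rw [← sub_eq_zero, ← oneCocycleClass_sub]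
      have h0 : zx - zy = 0 := by
        apply Subtype.ext
        ext σ
        exact hinj (zx - zy).1 (zx - zy).1.continuous (contOneCocycles.apply_mul_of_trivial htriv _)
          (sub_eq_zero.mpr hxy) σ
      rw [h0, oneCocycleClass_zero]
    · intro a
      obtain ⟨f, hf, hmul, hfa⟩ := hsurj a
      refine ⟨oneCocycleClass X ⟨ContinuousMap.mk f hf, fun g h => ?_⟩, ?_⟩
      · change f (g * h) = f g + X.ρ g (f h)
        rw [htriv]; exact hmul g h
      · rw [he₀]; exact hfa
  exact ⟨LinearEquiv.ofBijective _ hbij, fun z => by rw [LinearEquiv.ofBijective_apply]; exact he₀ z⟩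

/-- **`H¹(I_F, A) ≃ A` by evaluation at a tame `p`-generator, uniformly in `A`.** For a non-archimedean
local field `F` of residue characteristic `≠ p` there is `τ ∈ I_F`, a tame `p`-generator (every
continuous homomorphism of `I_F` into a discrete `p`-group `B` has image `⟨f τ⟩`), such that for every
continuous `ρ : Γ_F → Aut_{ℤ_p}(A)` on a discrete `p`-primary `A` which is UNRAMIFIED (`I_F` acts
trivially), `[z] ↦ z(τ)` is a `ℤ_p`-linear bijection `H¹_cont(I_F, A) = Hom_cont(I_F, A) ≃ A`.
"`H¹(Ī_ℓ, A) ≅ Hom(ℤ_p(1), A_{I_ℓ}) ≅ A_{I_ℓ}(−1)`" for `ε_ℓ` a topological generator of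
`I_ℓ/J_ℓ ≅ ℤ_p(1)`.
[cite: GreenbergVatsal2000, §2, proof of Prop. (2.4) (arXiv p. 22)]
[cite: SerreInventiones1972, §1.3 Prop. 1 and §1.7 Prop. 5] -/
theorem exists_forall_continuousCohomology_absInertia_equiv_eval (hℓ : ringChar 𝓀[F] ≠ p) :
    ∃ τ : ↥(absInertia F),
      (∀ (B : Type u) [Group B] [TopologicalSpace B] [DiscreteTopology B], IsPGroup p B →
        ∀ f : ↥(absInertia F) →* B, Continuous f → f.range = Subgroup.zpowers (f τ)) ∧
      ∀ {A : Type u} [AddCommGroup A] [Module ℤ_[p] A] [TopologicalSpace A]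
        [DiscreteTopology A] [ContinuousSMul ℤ_[p] A]
        (ρ : ContinuousRep (absoluteGaloisGroup F) ℤ_[p] A),
        (∀ a : A, ∃ k : ℕ, p ^ k • a = 0) → (∀ σ ∈ absInertia F, ∀ a : A, ρ σ a = a) →
        ∃ e : continuousCohomology 1 (subgroupRep ρ.toTopRep (absInertia F)) ≃ₗ[ℤ_[p]] A,
          ∀ z, e (oneCocycleClass _ z) = z.1 τ := by
  obtain ⟨τ, hgen, hτ⟩ := exists_absInertia_tame_generator F (Fact.out : p.Prime) hℓ
  refine ⟨τ, hgen, fun {A} _ _ _ _ _ ρ hA hunr => ?_⟩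
  obtain ⟨hinj, hsurj⟩ := hτ A hA
  exact continuousCohomology_absInertia_equiv_eval_of_bijective F ρ hunr τ hinj hsurj

/-- **`H¹(I_F, A) ≃ A` by evaluation at a tame `p`-generator** (one module at a time; the shape consumed
by the local `Σ`-atom at places of good reduction): for `ρ : Γ_F → Aut_{ℤ_p}(A)` continuous, `A`
discrete `p`-primary and unramified, `p ≠` residue characteristic, there are `τ ∈ I_F` and a
`ℤ_p`-linear bijection `e : H¹_cont(I_F, A) ≃ A` with `e [z] = z(τ)`.
[cite: GreenbergVatsal2000, §2, proof of Prop. (2.4) (arXiv p. 22)]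
[cite: SerreInventiones1972, §1.3 Prop. 1 and §1.7 Prop. 5] -/
theorem exists_continuousCohomology_absInertia_equiv_eval
    (ρ : ContinuousRep (absoluteGaloisGroup F) ℤ_[p] A) (hℓ : ringChar 𝓀[F] ≠ p)
    (hA : ∀ a : A, ∃ k : ℕ, p ^ k • a = 0) (hunr : ∀ σ ∈ absInertia F, ∀ a : A, ρ σ a = a) :
    ∃ (τ : ↥(absInertia F)) (e : continuousCohomology 1 (subgroupRep ρ.toTopRep (absInertia F)) ≃ₗ[ℤ_[p]] A),
      ∀ z, e (oneCocycleClass _ z) = z.1 τ := by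
  obtain ⟨τ, -, hτ⟩ := exists_forall_continuousCohomology_absInertia_equiv_eval F hℓ
  exact ⟨τ, hτ ρ hA hunr⟩

/-- **Frobenius on `H¹(I_F, A) ≃ A`: `q • e(φ·c) = ρ(φ)(e c)`.** Under an evaluation bijection
`e [z] = z(τ)` the conjugation action of a Frobenius `φ` (`conjMap`: `(φ·z)(σ) = ρ(φ) z(φ⁻¹σφ)`) is
`q⁻¹ ρ(φ)` ("`H¹(I_ℓ, A) ≅ A(−1)` as a Frobenius module"; `A[p^k]` finite for all `k`).
From `residueFieldCard_nsmul_conj_pullback_apply`.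
[cite: GreenbergVatsal2000, §2, proof of Prop. (2.4) (arXiv p. 22)]
[cite: SerreInventiones1972, §1.8 Prop. 6] -/
theorem residueFieldCard_nsmul_equiv_conjMap
    (ρ : ContinuousRep (absoluteGaloisGroup F) ℤ_[p] A) (hℓ : ringChar 𝓀[F] ≠ p)
    (hA : ∀ a : A, ∃ k : ℕ, p ^ k • a = 0) (hfin : ∀ k : ℕ, Set.Finite {a : A | p ^ k • a = 0})
    (hunr : ∀ σ ∈ absInertia F, ∀ a : A, ρ σ a = a)
    {φ : absoluteGaloisGroup F} (hφ : IsFrobPow φ 1) {τ : ↥(absInertia F)}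
    (e : continuousCohomology 1 (subgroupRep ρ.toTopRep (absInertia F)) ≃ₗ[ℤ_[p]] A)
    (he : ∀ z, e (oneCocycleClass _ z) = z.1 τ)
    (c : continuousCohomology 1 (subgroupRep ρ.toTopRep (absInertia F))) :
    residueFieldCard F • e (conjMap ρ.toTopRep (absInertia F) φ 1 c) = ρ φ (e c) := by
  obtain ⟨z, rfl⟩ := oneCocycleClass_surjective _ c
  rw [conjMap_oneCocycleClass, he, he]
  exact residueFieldCard_nsmul_conj_pullback_apply F ρ hℓ hA hfin hunr hφ z τ

end H1

end Literature.NumberTheory.GaloisRepresentations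

end
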